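import Literature.NumberTheory.Automorphic.AsaiSignCont
import Literature.NumberTheory.Automorphic.MokStandardBaseChangeDescentContinuation
import Literature.NumberTheory.Automorphic.PairLFunctionPolesRepDataBoundaryRankOne
import Literature.NumberTheory.Automorphic.SatakeParameterBoundHolds
import Literature.NumberTheory.Automorphic.AdelicGroupDataAutomorphicMeasureProofs
import HarnessLib

/-!
# Absolute convergence of the partial Asai Euler product of a cuspidal representation in a
# right half-plane

Topic `NumberTheory/Automorphic`; namespace `Literature.NumberTheory.Automorphic`.  Theorem-only
companion of `AsaiSign` / `AsaiSignCont` / `AsaiSignContinuation` (provefact unit for the named fact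
`GrbacShahidi2015_partialAsaiL_at_one`, 2026-08-16).

The named facts `GrbacShahidi2015_partialAsaiL_at_one` (Grbac–Shahidi 2015, Thm. 4.3 at `s = 1`) and
`Mok2014_partialAsaiL_continuation_pole_dichotomy` (Mok's dichotomy in continuation form) both open
with the clause

  (i) *there is `σ₀ ≥ 1` such that the raw partial Asai Euler product*
      `∏_{v ∉ S} det(1 - As^η(t_v) q_v^{-s})⁻¹` *of the Asai datum `(S, A)` of the cuspidal `Π` is
      multipliable for `Re s > σ₀`*

— in print: "The product `L(s, r(π), V)` converges absolutely, uniformly in compact subsets, in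
some right half-plane" (Flicker 1988, Theorem p. 297, first clause; p. 310: "Since `π` is unitary
the product … is absolutely convergent in some right half-plane"); "the product over all places
defining the global `L`-functions converges absolutely in some right half-plane `Re(s) > C`, where
`C` is sufficiently large" (Grbac–Shahidi 2015, §2.A, p. 191); in general Langlands, *Euler
products* (1971), and Borel, Corvallis 1979, §13 (absolute convergence of automorphic Euler
products from a polynomial bound on the Hecke eigenvalues).  This file **proves clause (i)** for
every cuspidal automorphic representation datum `Π` of `GL_N(𝔸_E)` (`CuspidalAutomorphicRepData`,
arbitrary central character), every Asai datum and both signs, from theorems of the tree: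

* the Borel–Jacquet normalisation `t_{Π,w} = q_w^{z} t_{Π₀,w}` off a finite set, `Π₀ ≤ L²_cusp`
  (`CuspidalAutomorphicRepData.exists_satake_eq_cpow_mul_L2_holds`, Borel–Jacquet 1979, 5.7);
* Jacquet–Shalika's bound `|μ_{j,w}| ≤ q_w^{1/2}` for the Satake parameters of `Π₀`
  (`norm_satakeParameter_le_sqrt_holds`, Jacquet–Shalika 1981 I, (5.1.3) / Cor. 2.5);
* the automorphic measure on `GL_N(E) A_G \ GL_N(𝔸_E)` (`exists_isAutomorphicMeasure_gl_holds`).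

Hence `‖a‖ ≤ q_w^{|Re z| + 1/2} ≤ q_v^{2|Re z| + 1}` for every Satake parameter `a` recorded by the
datum above all but finitely many `v ∉ S` (`q_w = q_v^{f(w|v)}`, `f ≤ 2`), each unramified Asai
factor is a product of at most `N + C(N,2) + N²` numbers `1 - ζ` with `‖ζ‖ ≤ q_v^{2B} q_v^{-Re s}`
(`B = 2|Re z| + 1`), and for `Re s > 2B + 1` the product of the factors converges absolutely
(`multipliable_one_add_of_summable` against `∑_v q_v^{-(Re s - 2B)} < ∞`) to a non-zero value, so
the product of their inverses converges; the finitely many exceptional places change nothing.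

## Main statements

* `exists_eval_asaiLocalPolynomial_eq_multiset_prod_of_norm_le`,
  `norm_eval_asaiLocalPolynomial_sub_one_le_of_norm_le`,
  `eval_asaiLocalPolynomial_ne_zero_of_norm_le` — the local estimate under a bound `‖a‖ ≤ M`
  (the case `M = 1` is `MokStandardBaseChangeDescentContinuation`'s tempered estimate);
* `multipliable_inv_of_norm_sub_one_le_off_finite` — inverses of a family `P_i ≠ 0` with
  `∑ ‖P_i - 1‖ < ∞` off a finite set are multipliable (pure analysis);
* `multipliable_inv_eval_asaiLocalPolynomial_of_norm_le_rpow` — clause (i) for a Satake family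
  with an almost-everywhere polynomial bound `‖a‖ ≤ q_v^B`, on `Re s > 2B + 1`;
* `CuspidalAutomorphicRepData.exists_multipliable_asaiEulerFactors` — **clause (i) for cuspidal
  data** (both signs at once, one `σ₀` per Asai datum);
* `CuspidalAutomorphicRepData.GrbacShahidi2015_partialAsaiL_at_one_clause_i` — the same in the
  exact shape of the first conjunct of `GrbacShahidi2015_partialAsaiL_at_one`.

What this does NOT give: clause (ii) of the fact (the analytic continuation to
`{1 < Re s} ∪ B(1, δ)` with the right order and non-vanishing at `s = 1`), which is Grbac–Shahidi's
Thm. 4.3 proper (Langlands–Shahidi method on `U(n, n)` and Mok's endoscopic classification).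

## References

* Y. Z. Flicker, *Twisted tensors and Euler products*, Bull. Soc. Math. France 116 (1988),
  295–313: Theorem p. 297 (first clause), p. 310. [Flicker1988]
* N. Grbac, F. Shahidi, *Endoscopic transfer for unitary groups and holomorphy of Asai
  `L`-functions*, Pacific J. Math. 276 (2015), 185–211: §2.A, p. 191. [GrbacShahidi2015]
* H. Jacquet, J. A. Shalika, *On Euler products and the classification of automorphic
  representations I*, Amer. J. Math. 103 (1981), (5.1.3), Cor. 2.5. [JacquetShalikaAJM1981]
* A. Borel, H. Jacquet, *Automorphic forms and automorphic representations*, Proc. Sympos. Pure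
  Math. 33 (1979), part 1, 5.7. [BorelJacquetCorvallis1979]
-/

noncomputable section

open scoped Topology Classical
open NumberField IsDedekindDomain MeasureTheory Filter Polynomial

namespace Literature.NumberTheory.Automorphic

/-! ### The unramified Asai factor under a bound `‖a‖ ≤ M` on the Satake parameters -/

section Local

variable {F E : Type} [Field F] [Field E] [Algebra F E]

/-- The sign `η = ±1` has norm one in `ℂ`. [folklore] -/
private theorem norm_intCast_units_aux (η : ℤˣ) : ‖(((η : ℤ) : ℂ))‖ = 1 := by
  rcases Int.units_eq_one_or η with rfl | rfl <;> simp

/-- **The unramified Asai factor is a product of factors `1 - ζ` with `‖ζ‖ ≤ M² ‖x‖`** when the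
Satake parameters at `w` and `c • w` have norm at most `M ≥ 1` and `‖x‖ ≤ 1`:
`(asaiLocalPolynomial c A η w)(x)` is a product of at most
`card (A w) + C(card (A w), 2) + card (A w) · card (A (c • w))` complex numbers `f` with
`‖f - 1‖ ≤ M² ‖x‖` (inert: `f = 1 - η a x` or `1 - a b x²`; split: `f = 1 - a b x`).  The case `M = 1`
is `exists_eval_asaiLocalPolynomial_eq_multiset_prod`. [folklore] -/
theorem exists_eval_asaiLocalPolynomial_eq_multiset_prod_of_norm_le (c : E ≃ₐ[F] E)
    (A : SatakeFamily E) (η : ℤˣ) (w : HeightOneSpectrum (𝓞 E)) {x : ℂ} {M : ℝ} (hM : 1 ≤ M)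
    (hx : ‖x‖ ≤ 1) (hw : ∀ a ∈ A w, ‖a‖ ≤ M) (hcw : ∀ a ∈ A (c • w), ‖a‖ ≤ M) :
    ∃ T : Multiset ℂ, (asaiLocalPolynomial c A η w).eval x = T.prod ∧
      Multiset.card T ≤ Multiset.card (A w) + (Multiset.card (A w)).choose 2 +
        Multiset.card (A w) * Multiset.card (A (c • w)) ∧
      ∀ f ∈ T, ‖f - 1‖ ≤ M ^ 2 * ‖x‖ := by
  have hM0 : 0 ≤ M := zero_le_one.trans hM
  have hMM : M ≤ M ^ 2 := by nlinarith
  have hx0 : 0 ≤ ‖x‖ := norm_nonneg x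
  by_cases hfix : c • w = w
  · -- inert: `∏_a (1 - η a x) · ∏_{a,b} (1 - a b x²)`
    refine ⟨(A w).map (fun a => 1 - ((η : ℤ) : ℂ) * a * x) +
      ((A w).powersetCard 2).map (fun p => 1 - p.prod * x ^ 2), ?_, ?_, ?_⟩
    · rw [asaiLocalPolynomial_of_smul_eq A η hfix, asaiInertPolynomial, eval_mul,
        eval_multiset_prod, eval_multiset_prod, Multiset.prod_add, Multiset.map_map,
        Multiset.map_map]
      congr 1
      · refine congrArg _ (Multiset.map_congr rfl fun a _ => ?_)
        simp
      · refine congrArg _ (Multiset.map_congr rfl fun p _ => ?_)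
        simp
    · rw [Multiset.card_add, Multiset.card_map, Multiset.card_map, Multiset.card_powersetCard]
      exact Nat.le_add_right _ _
    · intro f hf
      rw [Multiset.mem_add] at hf
      rcases hf with hf | hf
      · obtain ⟨a, ha, rfl⟩ := Multiset.mem_map.mp hf
        rw [sub_sub_cancel_left, norm_neg, norm_mul, norm_mul, norm_intCast_units_aux, one_mul]
        calc ‖a‖ * ‖x‖ ≤ M * ‖x‖ := by gcongr; exact hw a ha
          _ ≤ M ^ 2 * ‖x‖ := by gcongr
      · obtain ⟨p, hp, rfl⟩ := Multiset.mem_map.mp hf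
        obtain ⟨hple, hpcard⟩ := Multiset.mem_powersetCard.mp hp
        obtain ⟨a, b, rfl⟩ := Multiset.card_eq_two.mp hpcard
        have ha : ‖a‖ ≤ M := hw a (Multiset.mem_of_le hple (by simp))
        have hb : ‖b‖ ≤ M := hw b (Multiset.mem_of_le hple (by simp))
        rw [sub_sub_cancel_left, norm_neg, norm_mul, Multiset.insert_eq_cons, Multiset.prod_cons,
          Multiset.prod_singleton, norm_mul, norm_pow]
        calc ‖a‖ * ‖b‖ * ‖x‖ ^ 2 ≤ M * M * ‖x‖ ^ 2 := by gcongr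
          _ = M ^ 2 * (‖x‖ * ‖x‖) := by ring
          _ ≤ M ^ 2 * (1 * ‖x‖) := by gcongr
          _ = M ^ 2 * ‖x‖ := by rw [one_mul]
  · -- split: `∏_{a, b} (1 - a b x)`
    refine ⟨(satakeTensor (A w) (A (c • w))).map (fun z => 1 - z * x), ?_, ?_, ?_⟩
    · rw [asaiLocalPolynomial_of_smul_ne A η hfix, satakePairPolynomial_eq_eulerPolynomial,
        eval_eulerPolynomial]
    · rw [Multiset.card_map, card_satakeTensor]
      exact Nat.le_add_left _ _
    · intro f hf
      obtain ⟨z, hz, rfl⟩ := Multiset.mem_map.mp hf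
      obtain ⟨p, hp, rfl⟩ := Multiset.mem_map.mp hz
      obtain ⟨ha, hb⟩ := Multiset.mem_product.mp hp
      rw [sub_sub_cancel_left, norm_neg, norm_mul, norm_mul]
      calc ‖p.1‖ * ‖p.2‖ * ‖x‖ ≤ M * M * ‖x‖ := by gcongr; exacts [hw _ ha, hcw _ hb]
        _ = M ^ 2 * ‖x‖ := by ring

/-- **Estimate of the unramified Asai factor under `‖a‖ ≤ M`**: for `M ≥ 1`, `‖x‖ ≤ 1` and
`M² ‖x‖ ≤ 1`, `‖(asaiLocalPolynomial c A η w)(x) - 1‖ ≤ (2 ^ K - 1) M² ‖x‖` with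
`K = card (A w) + C(card (A w), 2) + card (A w) · card (A (c • w))`
(`norm_multiset_prod_sub_one_le`). [folklore] -/
theorem norm_eval_asaiLocalPolynomial_sub_one_le_of_norm_le (c : E ≃ₐ[F] E) (A : SatakeFamily E)
    (η : ℤˣ) (w : HeightOneSpectrum (𝓞 E)) {x : ℂ} {M : ℝ} (hM : 1 ≤ M) (hx : ‖x‖ ≤ 1)
    (hw : ∀ a ∈ A w, ‖a‖ ≤ M) (hcw : ∀ a ∈ A (c • w), ‖a‖ ≤ M) (hδ : M ^ 2 * ‖x‖ ≤ 1) :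
    ‖(asaiLocalPolynomial c A η w).eval x - 1‖ ≤
      (2 ^ (Multiset.card (A w) + (Multiset.card (A w)).choose 2 +
        Multiset.card (A w) * Multiset.card (A (c • w))) - 1) * (M ^ 2 * ‖x‖) := by
  obtain ⟨T, hT, hcard, hf⟩ :=
    exists_eval_asaiLocalPolynomial_eq_multiset_prod_of_norm_le c A η w hM hx hw hcw
  rw [hT]
  refine (norm_multiset_prod_sub_one_le (by positivity) hδ T hf).trans ?_
  have h2 : (2 : ℝ) ^ Multiset.card T ≤
      2 ^ (Multiset.card (A w) + (Multiset.card (A w)).choose 2 +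
        Multiset.card (A w) * Multiset.card (A (c • w))) :=
    pow_le_pow_right₀ (by norm_num) hcard
  exact mul_le_mul_of_nonneg_right (by linarith) (by positivity)

/-- **Non-vanishing of the unramified Asai factor under `‖a‖ ≤ M`** when `M² ‖x‖ < 1`: every
factor `f` of `exists_eval_asaiLocalPolynomial_eq_multiset_prod_of_norm_le` has `‖f - 1‖ < 1`.
[folklore] -/
theorem eval_asaiLocalPolynomial_ne_zero_of_norm_le (c : E ≃ₐ[F] E) (A : SatakeFamily E)
    (η : ℤˣ) (w : HeightOneSpectrum (𝓞 E)) {x : ℂ} {M : ℝ} (hM : 1 ≤ M) (hx : ‖x‖ ≤ 1)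
    (hw : ∀ a ∈ A w, ‖a‖ ≤ M) (hcw : ∀ a ∈ A (c • w), ‖a‖ ≤ M) (hδ : M ^ 2 * ‖x‖ < 1) :
    (asaiLocalPolynomial c A η w).eval x ≠ 0 := by
  obtain ⟨T, hT, -, hf⟩ :=
    exists_eval_asaiLocalPolynomial_eq_multiset_prod_of_norm_le c A η w hM hx hw hcw
  rw [hT]
  exact multiset_prod_ne_zero_of_norm_sub_one_lt_one T fun f hfT => (hf f hfT).trans_lt hδ

end Local

/-! ### Inverses of an absolutely convergent product, up to finitely many factors -/

section Analysis

/-- **Inverses of a normally convergent product are multipliable, finitely many factors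
excepted.**  If `∑_{i ∉ T} ‖P_i - 1‖ < ∞` (majorant `u`) and `P_i ≠ 0` for `i` off a finite set `T`,
then `i ↦ (P_i)⁻¹` is multipliable (over ALL `i`): off `T` the product `∏ P_i` converges
(`multipliable_one_add_of_summable`) to a non-zero value (`tprod_one_add_ne_zero_of_summable`), so
the finite partial products of the inverses converge to its inverse; the finitely many remaining
factors form a product of finite multiplicative support. [folklore] -/
theorem multipliable_inv_of_norm_sub_one_le_off_finite {ι : Type} {P : ι → ℂ} {T : Set ι}
    (hT : T.Finite) {u : ι → ℝ} (hu : Summable u) (hle : ∀ i, i ∉ T → ‖P i - 1‖ ≤ u i)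
    (hne : ∀ i, i ∉ T → P i ≠ 0) : Multipliable fun i => (P i)⁻¹ := by
  classical
  -- `Q` : the family with the exceptional factors replaced by `1`
  set Q : ι → ℂ := fun i => if i ∈ T then 1 else P i with hQ
  have hQle : ∀ i, ‖Q i - 1‖ ≤ Tᶜ.indicator u i := by
    intro i
    by_cases hi : i ∈ T
    · simp [hQ, hi]
    · rw [Set.indicator_of_mem (Set.mem_compl hi)]
      simpa [hQ, hi] using hle i hi
  have hsum : Summable fun i => ‖Q i - 1‖ :=
    (hu.indicator Tᶜ).of_nonneg_of_le (fun i => norm_nonneg _) hQle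
  have hQne : ∀ i, Q i ≠ 0 := by
    intro i
    by_cases hi : i ∈ T
    · simp [hQ, hi]
    · simpa [hQ, hi] using hne i hi
  have hmulQ : Multipliable Q := by
    have h := multipliable_one_add_of_summable hsum
    simpa only [add_sub_cancel] using h
  have hQ0 : ∏' i, Q i ≠ 0 := by
    have h := tprod_one_add_ne_zero_of_summable (f := fun i => Q i - 1)
      (fun i => by rw [add_sub_cancel]; exact hQne i) hsum
    simpa only [add_sub_cancel] using h
  obtain ⟨L, hL⟩ := hmulQ
  have hL0 : L ≠ 0 := by rwa [hL.tprod_eq] at hQ0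
  have hinv : HasProd (fun i => (Q i)⁻¹) L⁻¹ := by
    unfold HasProd at hL ⊢
    simpa only [Finset.prod_inv_distrib] using hL.inv₀ hL0
  -- `r` : the exceptional factors alone
  set r : ι → ℂ := fun i => if i ∈ T then (P i)⁻¹ else 1 with hr
  have hrsupp : Function.mulSupport r ⊆ T := by
    intro i hi
    by_contra h
    exact hi (by simp [hr, h])
  have hmulr : Multipliable r :=
    multipliable_of_hasFiniteMulSupport (show Function.HasFiniteMulSupport r from hT.subset hrsupp)
  refine (hinv.multipliable.mul hmulr).congr fun i => ?_
  by_cases hi : i ∈ T <;> simp [hQ, hr, hi]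

end Analysis

/-! ### Clause (i) for a Satake family with a polynomial bound almost everywhere -/

section Family

variable {F E : Type} [Field F] [NumberField F] [Field E] [Algebra F E]

/-- **Multipliability of the inverse unramified Asai factors on `Re s > 2B + 1` under an
almost-everywhere bound `‖a‖ ≤ q_v^B`.**  Let `(S, A)` be a set of finite places of `F` and a Satake
family over `E` such that, for all `v ∉ S` outside a finite set `T`, the multisets `A w_v` and
`A (c • w_v)` (`w_v = placeAbove E v`) have at most `N` elements, all of norm `≤ q_v^B` (`B ≥ 0`).
Then for `Re s > 2B + 1` the family `v ↦ det(1 - As^η(t_v) q_v^{-s})⁻¹`, `v ∉ S`, is multipliable: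
with `x = q_v^{-s}` and `M = q_v^B`, `M² ‖x‖ = q_v^{2B - Re s} < 1`, so
`‖P_v(s) - 1‖ ≤ 2^K q_v^{-(Re s - 2B)}` (`K = N + C(N,2) + N²`,
`norm_eval_asaiLocalPolynomial_sub_one_le_of_norm_le`), summable (`summable_residueCard_rpow_neg`),
and `P_v(s) ≠ 0`; conclude by `multipliable_inv_of_norm_sub_one_le_off_finite`.  (Borel, Corvallis
§13; Flicker 1988, Theorem p. 297, first clause.) [folklore] -/
theorem multipliable_inv_eval_asaiLocalPolynomial_of_norm_le_rpow
    {S : Set (HeightOneSpectrum (𝓞 F))} (c : E ≃ₐ[F] E) (A : SatakeFamily E) (η : ℤˣ) (N : ℕ)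
    {B : ℝ} (hB : 0 ≤ B) {T : Set {v : HeightOneSpectrum (𝓞 F) // v ∉ S}} (hT : T.Finite)
    (hA : ∀ v : {v : HeightOneSpectrum (𝓞 F) // v ∉ S}, v ∉ T →
      (Multiset.card (A (placeAbove E v.1)) ≤ N ∧
        ∀ a ∈ A (placeAbove E v.1), ‖a‖ ≤ (v.1.residueCard : ℝ) ^ B) ∧
      (Multiset.card (A (c • placeAbove E v.1)) ≤ N ∧
        ∀ a ∈ A (c • placeAbove E v.1), ‖a‖ ≤ (v.1.residueCard : ℝ) ^ B))
    {s : ℂ} (hs : 2 * B + 1 < s.re) :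
    Multipliable fun v : {v : HeightOneSpectrum (𝓞 F) // v ∉ S} =>
      ((asaiLocalPolynomial c A η (placeAbove E v.1)).eval ((v.1.residueCard : ℂ) ^ (-s)))⁻¹ := by
  set K : ℕ := N + N.choose 2 + N * N with hK
  have hσ : 1 < s.re - 2 * B := by linarith
  -- `‖q_v^{-s}‖ = q_v^{-re s}` and the quantity `M² ‖x‖ = q_v^{-(re s - 2B)}`
  have hx : ∀ v : {v : HeightOneSpectrum (𝓞 F) // v ∉ S},
      ‖(v.1.residueCard : ℂ) ^ (-s)‖ = (v.1.residueCard : ℝ) ^ (-s.re) := fun v => by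
    rw [Complex.norm_natCast_cpow_of_pos (zero_lt_one.trans v.1.one_lt_residueCard), Complex.neg_re]
  have hδ : ∀ v : {v : HeightOneSpectrum (𝓞 F) // v ∉ S},
      ((v.1.residueCard : ℝ) ^ B) ^ 2 * ‖(v.1.residueCard : ℂ) ^ (-s)‖ =
        (v.1.residueCard : ℝ) ^ (-(s.re - 2 * B)) := fun v => by
    have hq0 : (0 : ℝ) < v.1.residueCard := by exact_mod_cast zero_lt_one.trans v.1.one_lt_residueCard
    rw [hx, ← Real.rpow_natCast, ← Real.rpow_mul hq0.le, ← Real.rpow_add hq0]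
    congr 1
    push_cast
    ring
  refine multipliable_inv_of_norm_sub_one_le_off_finite hT
    (u := fun v => (2 : ℝ) ^ K * (v.1.residueCard : ℝ) ^ (-(s.re - 2 * B)))
    (((summable_residueCard_rpow_neg hσ).subtype _).mul_left ((2 : ℝ) ^ K))
    (fun v hv => ?_) (fun v hv => ?_)
  · -- the estimate `‖P_v(s) - 1‖ ≤ 2^K q_v^{-(re s - 2B)}`
    have hq1 : (1 : ℝ) < v.1.residueCard := by exact_mod_cast v.1.one_lt_residueCard
    have hM : (1 : ℝ) ≤ (v.1.residueCard : ℝ) ^ B := Real.one_le_rpow hq1.le hB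
    have hx1 : ‖(v.1.residueCard : ℂ) ^ (-s)‖ ≤ 1 := by
      rw [hx]
      exact Real.rpow_le_one_of_one_le_of_nonpos hq1.le (by linarith)
    have hδ1 : ((v.1.residueCard : ℝ) ^ B) ^ 2 * ‖(v.1.residueCard : ℂ) ^ (-s)‖ ≤ 1 := by
      rw [hδ]
      exact Real.rpow_le_one_of_one_le_of_nonpos hq1.le (by linarith)
    obtain ⟨⟨hcard, hnorm⟩, ⟨hcard', hnorm'⟩⟩ := hA v hv
    refine (norm_eval_asaiLocalPolynomial_sub_one_le_of_norm_le c A η (placeAbove E v.1) hM hx1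
      hnorm hnorm' hδ1).trans ?_
    have hKle : Multiset.card (A (placeAbove E v.1)) +
          (Multiset.card (A (placeAbove E v.1))).choose 2 +
        Multiset.card (A (placeAbove E v.1)) * Multiset.card (A (c • placeAbove E v.1)) ≤ K :=
      Nat.add_le_add (Nat.add_le_add hcard (Nat.choose_le_choose 2 hcard))
        (Nat.mul_le_mul hcard hcard')
    have h2 : (2 : ℝ) ^ (Multiset.card (A (placeAbove E v.1)) +
          (Multiset.card (A (placeAbove E v.1))).choose 2 +
        Multiset.card (A (placeAbove E v.1)) * Multiset.card (A (c • placeAbove E v.1))) ≤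
        (2 : ℝ) ^ K := pow_le_pow_right₀ (by norm_num) hKle
    rw [hδ] at ⊢
    have hq0' : (0 : ℝ) ≤ (v.1.residueCard : ℝ) ^ (-(s.re - 2 * B)) := by positivity
    calc _ ≤ (2 : ℝ) ^ K * ((v.1.residueCard : ℝ) ^ (-(s.re - 2 * B))) :=
          mul_le_mul_of_nonneg_right (by linarith) hq0'
      _ = _ := rfl
  · -- no factor vanishes: `M² ‖x‖ = q_v^{-(re s - 2B)} < 1`
    have hq1 : (1 : ℝ) < v.1.residueCard := by exact_mod_cast v.1.one_lt_residueCard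
    have hM : (1 : ℝ) ≤ (v.1.residueCard : ℝ) ^ B := Real.one_le_rpow hq1.le hB
    have hx1 : ‖(v.1.residueCard : ℂ) ^ (-s)‖ ≤ 1 := by
      rw [hx]
      exact Real.rpow_le_one_of_one_le_of_nonpos hq1.le (by linarith)
    have hδlt : ((v.1.residueCard : ℝ) ^ B) ^ 2 * ‖(v.1.residueCard : ℂ) ^ (-s)‖ < 1 := by
      rw [hδ]
      exact Real.rpow_lt_one_of_one_lt_of_neg hq1 (by linarith)
    obtain ⟨⟨-, hnorm⟩, ⟨-, hnorm'⟩⟩ := hA v hv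
    exact eval_asaiLocalPolynomial_ne_zero_of_norm_le c A η (placeAbove E v.1) hM hx1 hnorm hnorm'
      hδlt

end Family

/-! ### Clause (i) for cuspidal automorphic representations -/

section Cuspidal

open AdelicGroupData

variable {F E : Type} [Field F] [NumberField F] [Field E] [NumberField E] [Algebra F E]
  {N : ℕ} {hcpt : isCompact_glFiniteIntegralLevel N E}

/-- **In a quadratic extension the residue field above `v ∉ S` of an Asai datum has at most `q_v²`
elements**: `q_w = q_v^{f(w|v)}` (`residueCard_eq_pow_inertiaDeg`) with `f = 2` at a `c`-fixed place
(`IsAsaiDatum.inertiaDeg_eq_two`) and `f = 1` at a place moved by `c`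
(`HeightOneSpectrum.inertiaDeg_eq_one_of_smul_ne`). [folklore] -/
theorem AutomorphicRepData.IsAsaiDatum.residueCard_le_sq (h2 : Module.finrank F E = 2)
    {π : AutomorphicRepData (AutomorphyDatum.gl N E hcpt)} {c : E ≃ₐ[F] E}
    {S : Set (HeightOneSpectrum (𝓞 F))} {A : SatakeFamily E} (hSA : π.IsAsaiDatum c S A)
    {w : HeightOneSpectrum (𝓞 E)} (hw : w.under (𝓞 F) ∉ S) :
    (w.residueCard : ℝ) ≤ ((w.under (𝓞 F)).residueCard : ℝ) ^ (2 : ℝ) := by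
  have hq := residueCard_eq_pow_inertiaDeg (F := F) w
  have hq1 : (1 : ℝ) ≤ (w.under (𝓞 F)).residueCard := by
    exact_mod_cast (w.under (𝓞 F)).one_lt_residueCard.le
  have hf : w.asIdeal.inertiaDeg (𝓞 F) ≤ 2 := by
    by_cases hcw : c • w = w
    · exact (hSA.inertiaDeg_eq_two hw hcw).le
    · rw [HeightOneSpectrum.inertiaDeg_eq_one_of_smul_ne h2 hcw]
      norm_num
  rw [Real.rpow_two]
  calc (w.residueCard : ℝ) = ((w.under (𝓞 F)).residueCard : ℝ) ^ w.asIdeal.inertiaDeg (𝓞 F) := by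
        rw [hq]; push_cast; rfl
    _ ≤ ((w.under (𝓞 F)).residueCard : ℝ) ^ 2 := pow_le_pow_right₀ hq1 hf

/-- **Clause (i) of `GrbacShahidi2015_partialAsaiL_at_one` / `Mok2014_partialAsaiL_continuation_pole_dichotomy`,
proved: the partial Asai Euler product of a cuspidal representation converges in a right
half-plane.**  For `[E : F] = 2` with non-trivial automorphism `c`, a cuspidal automorphic
representation datum `Π` of `GL_N(𝔸_E)`, `N ≥ 1` (`CuspidalAutomorphicRepData`, arbitrary central
character) and an Asai datum `(S, A)` of `Π` (`IsAsaiDatum`), there is `σ₀ ≥ 1` such that for both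
signs `η` and every `s` with `Re s > σ₀` the family of inverse unramified Asai factors
`v ↦ det(1 - As^η(t_v) q_v^{-s})⁻¹`, `v ∉ S` — whose unconditional product is
`partialAsaiL S c A η s` — is multipliable.  Printed: "The product `L(s, r(π), V)` converges
absolutely, uniformly in compact subsets, in some right half-plane" (Flicker 1988, Theorem p. 297);
"the product over all places defining the global `L`-functions converges absolutely in some right
half-plane `Re(s) > C`" (Grbac–Shahidi 2015, §2.A).  Proof: off a finite set of places of `E` the
Satake parameters of `Π` are `q_w^{z} ·` those of a cuspidal `Π₀ ≤ L²_cusp`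
(`CuspidalAutomorphicRepData.exists_satake_eq_cpow_mul_L2_holds`, Borel–Jacquet 5.7), which are
bounded by `q_w^{1/2}` (`norm_satakeParameter_le_sqrt_holds`, Jacquet–Shalika (5.1.3)); the datum
records exactly these parameters (`IsAsaiDatum.hasSatakeParamAt` and the dictionary), so above all
but finitely many `v ∉ S` every recorded parameter has norm `≤ q_w^{|Re z| + 1/2} ≤ q_v^{2|Re z| + 1}`
(`IsAsaiDatum.residueCard_le_sq`), and `multipliable_inv_eval_asaiLocalPolynomial_of_norm_le_rpow`
applies with `B = 2|Re z| + 1`, `σ₀ = 2B + 1`.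
[cite: Flicker1988, Theorem p. 297 (first clause) and p. 310] [cite: GrbacShahidi2015, §2.A p. 191]
[cite: BorelJacquetCorvallis1979, 5.7] [cite: JacquetShalikaAJM1981, (5.1.3)] -/
theorem CuspidalAutomorphicRepData.exists_multipliable_asaiEulerFactors
    (h2 : Module.finrank F E = 2) {c : E ≃ₐ[F] E} (hN : 0 < N)
    (π : CuspidalAutomorphicRepData N E hcpt) {S : Set (HeightOneSpectrum (𝓞 F))}
    {A : SatakeFamily E} (hSA : π.1.IsAsaiDatum c S A) :
    ∃ σ₀ : ℝ, 1 ≤ σ₀ ∧ ∀ (η : ℤˣ) (s : ℂ), σ₀ < s.re →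
      Multipliable fun v : {v : HeightOneSpectrum (𝓞 F) // v ∉ S} =>
        ((asaiLocalPolynomial c A η (placeAbove E v.1)).eval ((v.1.residueCard : ℂ) ^ (-s)))⁻¹ := by
  classical
  haveI : NeZero N := ⟨hN.ne'⟩
  obtain ⟨μ, hμ⟩ := AdelicGroupData.exists_isAutomorphicMeasure_gl_holds (n := N) (K := E)
  haveI := hμ
  obtain ⟨z, P, S₁, αP, hS₁, hαP, hdict⟩ :=
    CuspidalAutomorphicRepData.exists_satake_eq_cpow_mul_L2_holds μ π
  set B : ℝ := 2 * |z.re| + 1 with hB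
  have hB0 : 0 ≤ B := by positivity
  refine ⟨2 * B + 1, by linarith, fun η s hs => ?_⟩
  -- the finitely many `v ∉ S` with a place of `S₁` among `{w_v, c • w_v}`
  set T : Set {v : HeightOneSpectrum (𝓞 F) // v ∉ S} :=
    {v | placeAbove E v.1 ∈ S₁ ∨ c • placeAbove E v.1 ∈ S₁} with hT
  have hTfin : T.Finite := by
    have himg : ((fun w : HeightOneSpectrum (𝓞 E) => w.under (𝓞 F)) '' S₁).Finite := hS₁.image _
    refine (himg.preimage Subtype.val_injective.injOn).subset ?_
    rintro v (hv | hv)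
    · exact ⟨_, hv, placeAbove_under v.1⟩
    · exact ⟨_, hv, (HeightOneSpectrum.under_algEquiv_smul F E c (placeAbove E v.1)).trans
        (placeAbove_under v.1)⟩
  refine multipliable_inv_eval_asaiLocalPolynomial_of_norm_le_rpow c A η N hB0 hTfin
    (fun v hv => ?_) hs
  -- the bound at a place `w ∉ S₁` above `v ∉ S`
  have key : ∀ w : HeightOneSpectrum (𝓞 E), w.under (𝓞 F) = v.1 → w ∉ S₁ →
      Multiset.card (A w) ≤ N ∧ ∀ a ∈ A w, ‖a‖ ≤ (v.1.residueCard : ℝ) ^ B := by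
    intro w hwv hwS₁
    have hwS : w.under (𝓞 F) ∉ S := by rw [hwv]; exact v.2
    have hSat : π.1.HasSatakeParamAt w (A w) := hSA.hasSatakeParamAt hwS
    have hAw : A w = (αP w).map (((w.residueCard : ℂ) ^ z) * ·) := (hdict w hwS₁ (A w)).mp hSat
    refine ⟨hSat.card_eq.le, fun a ha => ?_⟩
    rw [hAw] at ha
    obtain ⟨a₀, ha₀, rfl⟩ := Multiset.mem_map.mp ha
    have hqw1 : (1 : ℝ) < w.residueCard := by exact_mod_cast w.one_lt_residueCard
    have hqw0 : (0 : ℝ) < w.residueCard := zero_lt_one.trans hqw1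
    have hqv0 : (0 : ℝ) ≤ (v.1.residueCard : ℝ) := by positivity
    have hb : ‖a₀‖ ≤ Real.sqrt w.residueCard := norm_satakeParameter_le_sqrt_holds P hαP hwS₁ ha₀
    have hsq : (w.residueCard : ℝ) ≤ (v.1.residueCard : ℝ) ^ (2 : ℝ) := by
      have h := hSA.residueCard_le_sq h2 hwS
      rwa [hwv] at h
    calc ‖(w.residueCard : ℂ) ^ z * a₀‖ = (w.residueCard : ℝ) ^ z.re * ‖a₀‖ := by
          rw [norm_mul, Complex.norm_natCast_cpow_of_pos (zero_lt_one.trans w.one_lt_residueCard)]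
      _ ≤ (w.residueCard : ℝ) ^ |z.re| * (w.residueCard : ℝ) ^ (1 / 2 : ℝ) :=
          mul_le_mul (Real.rpow_le_rpow_of_exponent_le hqw1.le (le_abs_self _))
            (by rwa [← Real.sqrt_eq_rpow]) (norm_nonneg _) (by positivity)
      _ = (w.residueCard : ℝ) ^ (|z.re| + 1 / 2) := by rw [← Real.rpow_add hqw0]
      _ ≤ ((v.1.residueCard : ℝ) ^ (2 : ℝ)) ^ (|z.re| + 1 / 2) :=
          Real.rpow_le_rpow hqw0.le hsq (by positivity)
      _ = (v.1.residueCard : ℝ) ^ B := by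
          rw [← Real.rpow_mul hqv0, hB]
          congr 1
          ring
  simp only [hT, Set.mem_setOf_eq, not_or] at hv
  exact ⟨key _ (placeAbove_under v.1) hv.1,
    key _ (by rw [HeightOneSpectrum.under_algEquiv_smul, placeAbove_under]) hv.2⟩

/-- **Clause (i) of `GrbacShahidi2015_partialAsaiL_at_one`, in its exact shape** (one sign): for
`[E : F] = 2`, `c ≠ 1` not even needed, a cuspidal `Π` on `GL_N(𝔸_E)` with `N ≥ 1`, an Asai datum
`(S, A)` and a sign `η`, there is `σ₀ ≥ 1` with the inverse unramified Asai factors multipliable for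
`Re s > σ₀` (`exists_multipliable_asaiEulerFactors`).  The remaining conjunct (ii) of the named fact
— the continuation `G` of `(s - 1)^k L^S(s, Π, As^η)` to `{1 < Re s} ∪ B(1, δ)` with `G(1) ≠ 0` — is
Grbac–Shahidi's Thm. 4.3 proper and is not proved here.
[cite: Flicker1988, Theorem p. 297 (first clause)] [cite: GrbacShahidi2015, §2.A p. 191] -/
theorem CuspidalAutomorphicRepData.GrbacShahidi2015_partialAsaiL_at_one_clause_i
    (h2 : Module.finrank F E = 2) {c : E ≃ₐ[F] E} (hN : 0 < N)
    (π : CuspidalAutomorphicRepData N E hcpt) {S : Set (HeightOneSpectrum (𝓞 F))}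
    {A : SatakeFamily E} (η : ℤˣ) (hSA : π.1.IsAsaiDatum c S A) :
    ∃ σ₀ : ℝ, 1 ≤ σ₀ ∧ ∀ s : ℂ, σ₀ < s.re →
      Multipliable fun v : {v : HeightOneSpectrum (𝓞 F) // v ∉ S} =>
        ((asaiLocalPolynomial c A η (placeAbove E v.1)).eval ((v.1.residueCard : ℂ) ^ (-s)))⁻¹ := by
  obtain ⟨σ₀, hσ₀, h⟩ := π.exists_multipliable_asaiEulerFactors h2 hN hSA
  exact ⟨σ₀, hσ₀, fun s hs => h η s hs⟩

end Cuspidal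

end Literature.NumberTheory.Automorphic

end
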